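import Mathlib
import Summits.ValiantsHypothesis.ValiantsHypothesis.Theorems.ZeroOneTransfer.Negative.LowDegreeCofactor
import Literature.Computability.AlgebraicComplexity.NestFreeMatchingPoly
import Literature.Computability.AlgebraicComplexity.IMMInVPProofs
import HarnessLib

/-!
# Route FifoMatching — crux `NNLowDegreeCofactorHard` (stmt-ValiantsHypothesis-22993), line `freed_vertices`:
# stub S1 `stub_cofactorBuysVertices` — a cofactor of degree `δ` buys at most `2δ` freed vertices

Registered line `Cruxes/NNLowDegreeCofactorHard/Lines/freed_vertices.lean` (tenure g6, 2026-08-27):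
`NNLowDegreeCofactorHard` (every nonzero cofactor `h ∈ ℝ≥0[x]` of degree `≤ d` leaves `NN_n`
quasi-polynomially hard) from S1 (this file) → S2 `stub_carveInterval` → S3 `stub_supportGenericQPHard`.

**S1, verbatim.** For every nonzero `h ∈ ℝ≥0[x_(i,j)]` (`i, j < 2n`) there are a vertex set
`R ⊆ [2n]` with `|R| ≤ 2·deg h` and a polynomial `q` with the support of
`NN_n^R := NN_n[x_e := 1 for every arc e touching R]` and `L₊(q) ≤ L₊(NN_n · h)`.

## Proof (the VERTEX analogue of the landed ROW theorem `ZeroOneTransfer/Negative/LowDegreeCofactor.lean`)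

Grade the arc variables by vertex potentials `w(x_(i,j)) = B^i + B^j`, `B = 2·deg h + 1` (§1).  The
`w`-weight of a monomial `d` is the base-`B` number whose digits are the VERTEX DEGREES of `d` (number
of arc-endpoints at each vertex, loops counted twice); the digits are `≤ 2·deg d < B`, so all monomials
of the top `w`-component `top_w h` have the same vertex-degree vector (`eq_of_sum_mul_pow_eq`), whose
support `R` has at most `2·deg h` vertices, and every arc variable of `top_w h` has both endpoints in
`R` (`exists_vertices_topComponent`).  `NN_n` is `w`-homogeneous — every perfect matching touches every
vertex exactly once (§2, `isWeightedHomogeneous_nestFreeMatchingPoly`) — so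
`top_w(NN_n · h) = NN_n · top_w h` (`topComponent_mul`) and initial forms are free
(`complexity_topComponent_le`).  Freeing the arcs touching `R` (a projection: inputs `1`, `x_e` are
free, `complexity_aeval_le`) turns `top_w h` into the nonzero constant `η = Σ coeff` and `NN_n` into
`NN_n^R`; so `q := (NN_n · top_w h)[R-arcs := 1] = NN_n^R · η` has the support of `NN_n^R` and
`L₊(q) ≤ L₊(NN_n · top_w h) ≤ L₊(NN_n · h)`.

Honest framing: bookkeeping stub of an OPEN crux (the line still rests on S2, S3); the crux is a rung
strictly between `NNMonotoneHard` (proved) and the load-bearing `NNDivisionHard` (open) on a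
conditional route; nothing here bears on `VP ≠ VNP` (NOT proved).  Definitions: the bookkeeping
functions `vertexWeight`, `vertexDeg` only; no named facts.
-/

noncomputable section

-- Sub = Summit single-conjunct layout: the duplicated namespace component is mandated by the tree.
set_option linter.dupNamespace false

namespace Summit.ValiantsHypothesis.ValiantsHypothesis.Theorems.FifoMatching.NNLowDegreeCofactorHard

open MvPolynomial Finset Literature.Computability.AlgebraicComplexity
open Summit.ValiantsHypothesis.ValiantsHypothesis.Theorems.ZeroOneTransfer.Negative
open scoped NNReal

variable {m : ℕ}

/-! ### §1 Vertex potentials: the cofactor's top component lives on few vertices -/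

/-- The vertex-potential weight in base `B`: the arc variable `x_(i,j)` weighs `B^i + B^j`.
[folklore] -/
def vertexWeight (B : ℕ) : Fin m × Fin m → ℕ := fun e => B ^ (e.1 : ℕ) + B ^ (e.2 : ℕ)

/-- The vertex degree of a monomial `d` at the vertex `v`: the number of arc-endpoints of `d` at `v`
(with multiplicity; a loop `(v,v)` counts twice). [folklore] -/
def vertexDeg (d : (Fin m × Fin m) →₀ ℕ) (v : Fin m) : ℕ :=
  (∑ e ∈ d.support with e.1 = v, d e) + ∑ e ∈ d.support with e.2 = v, d e

/-- The vertex weight of a monomial is its base-`B` number with digits the vertex degrees.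
[folklore] -/
theorem weight_vertexWeight (B : ℕ) (d : (Fin m × Fin m) →₀ ℕ) :
    Finsupp.weight (vertexWeight B) d = ∑ v : Fin m, vertexDeg d v * B ^ (v : ℕ) := by
  classical
  rw [Finsupp.weight_apply, Finsupp.sum]
  simp only [vertexWeight, smul_eq_mul, mul_add, Finset.sum_add_distrib, vertexDeg, add_mul,
    Finset.sum_mul]
  congr 1
  · rw [← Finset.sum_fiberwise d.support Prod.fst (fun e => d e * B ^ (e.1 : ℕ))]
    refine Finset.sum_congr rfl fun v _ => Finset.sum_congr rfl fun e he => ?_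
    rw [(Finset.mem_filter.mp he).2]
  · rw [← Finset.sum_fiberwise d.support Prod.snd (fun e => d e * B ^ (e.2 : ℕ))]
    refine Finset.sum_congr rfl fun v _ => Finset.sum_congr rfl fun e he => ?_
    rw [(Finset.mem_filter.mp he).2]

/-- The vertex degrees sum to twice the degree (every arc has two endpoints). [folklore] -/
theorem sum_vertexDeg (d : (Fin m × Fin m) →₀ ℕ) :
    ∑ v : Fin m, vertexDeg d v = 2 * d.sum fun _ k => k := by
  classical
  rw [Finsupp.sum]
  simp only [vertexDeg, Finset.sum_add_distrib]
  rw [Finset.sum_fiberwise d.support Prod.fst (fun e => d e),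
    Finset.sum_fiberwise d.support Prod.snd (fun e => d e)]
  ring

/-- Vertex degrees are at most twice the degree. [folklore] -/
theorem vertexDeg_le (d : (Fin m × Fin m) →₀ ℕ) (v : Fin m) :
    vertexDeg d v ≤ 2 * d.sum fun _ k => k := by
  rw [← sum_vertexDeg]
  exact Finset.single_le_sum (f := fun v => vertexDeg d v) (fun _ _ => Nat.zero_le _)
    (Finset.mem_univ v)

/-- The vertices of positive vertex degree are at most `2·deg d` many. [folklore] -/
theorem card_filter_vertexDeg_pos_le (d : (Fin m × Fin m) →₀ ℕ) :
    (Finset.univ.filter fun v : Fin m => 0 < vertexDeg d v).card ≤ 2 * d.sum fun _ k => k := by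
  classical
  calc (Finset.univ.filter fun v : Fin m => 0 < vertexDeg d v).card
      = ∑ v ∈ Finset.univ.filter (fun v : Fin m => 0 < vertexDeg d v), 1 := by simp
    _ ≤ ∑ v ∈ Finset.univ.filter (fun v : Fin m => 0 < vertexDeg d v), vertexDeg d v :=
        Finset.sum_le_sum fun v hv => (Finset.mem_filter.mp hv).2
    _ ≤ ∑ v : Fin m, vertexDeg d v :=
        Finset.sum_le_sum_of_subset_of_nonneg (Finset.filter_subset _ _) fun _ _ _ => Nat.zero_le _
    _ = 2 * d.sum fun _ k => k := sum_vertexDeg d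

/-- An arc occurring in `d` makes the vertex degrees of both its endpoints positive. [folklore] -/
theorem vertexDeg_pos_of_mem {d : (Fin m × Fin m) →₀ ℕ} {e : Fin m × Fin m}
    (he : e ∈ d.support) : 0 < vertexDeg d e.1 ∧ 0 < vertexDeg d e.2 := by
  classical
  have hpos : 0 < d e := Nat.pos_of_ne_zero (Finsupp.mem_support_iff.mp he)
  constructor
  · have hmem : e ∈ d.support.filter (fun u => u.1 = e.1) := Finset.mem_filter.mpr ⟨he, rfl⟩
    exact lt_of_lt_of_le hpos ((Finset.single_le_sum (f := fun u => d u)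
      (fun _ _ => Nat.zero_le _) hmem).trans (Nat.le_add_right _ _))
  · have hmem : e ∈ d.support.filter (fun u => u.2 = e.2) := Finset.mem_filter.mpr ⟨he, rfl⟩
    exact lt_of_lt_of_le hpos ((Finset.single_le_sum (f := fun u => d u)
      (fun _ _ => Nat.zero_le _) hmem).trans (Nat.le_add_left _ _))

/-- **The top vertex-potential component of a nonzero `h` lives on at most `2·deg h` vertices**:
with `B = 2·deg h + 1`, all monomials of `top_{vertexWeight B} h` have the same vertex-degree
vector, whose support `R` has at most `2·deg h` vertices, and both endpoints of every arc variable
of every such monomial lie in `R`. [folklore] -/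
theorem exists_vertices_topComponent {h : MvPolynomial (Fin m × Fin m) ℝ≥0} (hh : h ≠ 0) :
    ∃ R : Finset (Fin m), R.card ≤ 2 * h.totalDegree ∧
      ∀ d ∈ (topComponent (vertexWeight (2 * h.totalDegree + 1)) h).support, ∀ e ∈ d.support,
        e.1 ∈ R ∧ e.2 ∈ R := by
  classical
  set B := 2 * h.totalDegree + 1 with hB
  set hs := topComponent (vertexWeight B) h with hhs
  have hne : hs ≠ 0 := topComponent_ne_zero _ hh
  obtain ⟨d₀, hd₀⟩ := exists_coeff_ne_zero hne
  have hd₀s : d₀ ∈ hs.support := mem_support_iff.mpr hd₀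
  refine ⟨Finset.univ.filter fun v => 0 < vertexDeg d₀ v, ?_, ?_⟩
  · refine (card_filter_vertexDeg_pos_le d₀).trans ?_
    exact Nat.mul_le_mul_left 2 (le_totalDegree (support_topComponent_subset _ h hd₀s))
  · intro d hd e he
    -- `d` and `d₀` have the same vertex weight, hence the same vertex degrees
    have hwd : Finsupp.weight (vertexWeight B) d = weightedTotalDegree (vertexWeight B) h := by
      have := mem_support_iff.mp hd
      rw [hhs, coeff_topComponent] at this
      by_contra hne'
      exact this (if_neg hne')
    have hwd₀ : Finsupp.weight (vertexWeight B) d₀ = weightedTotalDegree (vertexWeight B) h := by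
      have := mem_support_iff.mp hd₀s
      rw [hhs, coeff_topComponent] at this
      by_contra hne'
      exact this (if_neg hne')
    have hlt : ∀ d' ∈ hs.support, ∀ v, vertexDeg d' v < B := by
      intro d' hd' v
      have := le_totalDegree (support_topComponent_subset _ h hd')
      have := vertexDeg_le d' v
      omega
    have heq : vertexDeg d = vertexDeg d₀ :=
      eq_of_sum_mul_pow_eq (vertexDeg d) (vertexDeg d₀) (hlt d hd) (hlt d₀ hd₀s)
        (by rw [← weight_vertexWeight, ← weight_vertexWeight, hwd, hwd₀])
    have hp := vertexDeg_pos_of_mem he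
    rw [heq] at hp
    simp only [Finset.mem_filter, Finset.mem_univ, true_and]
    exact hp

/-! ### §2 `NN_n` is homogeneous for every vertex potential -/

/-- The vertex weight of the arc set of a perfect matching is `Σ_v B^v`: every vertex is an endpoint
of exactly one arc. [folklore] -/
theorem weight_arcExponent {M : Fin m → Fin m} (hM : M ∈ perfectMatchings m) (B : ℕ) :
    Finsupp.weight (vertexWeight B) (arcExponent M) = ∑ v : Fin m, B ^ (v : ℕ) := by
  classical
  obtain ⟨hinv, hfp⟩ := mem_perfectMatchings.1 hM
  have hinj : Function.Injective M := Function.Involutive.injective hinv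
  rw [arcExponent, map_sum]
  simp only [Finsupp.weight_apply, Finsupp.sum_single_index, zero_smul, one_smul, vertexWeight]
  rw [Finset.sum_add_distrib]
  -- openers and closers partition the vertices
  have himg : ∑ i ∈ openers M, B ^ ((M i : Fin m) : ℕ) = ∑ j ∈ (openers M).image M, B ^ (j : ℕ) := by
    rw [Finset.sum_image fun i _ j _ h => hinj h]
  rw [himg, image_openers hM, openers]
  have hneg : (Finset.univ.filter fun i : Fin m => M i < i) =
      Finset.univ.filter fun i : Fin m => ¬ i < M i := by
    refine Finset.filter_congr fun i _ => ?_
    constructor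
    · exact fun h => not_lt.2 h.le
    · exact fun h => lt_of_le_of_ne (not_lt.1 h) (hfp i)
  rw [hneg, Finset.sum_filter_add_sum_filter_not]

/-- **`NN_n` is `vertexWeight B`-homogeneous of weight `Σ_v B^v`** (every perfect matching touches
every vertex exactly once). [folklore] -/
theorem isWeightedHomogeneous_nestFreeMatchingPoly (n B : ℕ) :
    IsWeightedHomogeneous (vertexWeight B) (nestFreeMatchingPoly n ℝ≥0)
      (∑ v : Fin (2 * n), B ^ (v : ℕ)) := by
  rw [nestFreeMatchingPoly_eq_sum_arcMonomial]
  refine IsWeightedHomogeneous.sum _ _ _ fun M hM => ?_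
  rw [arcMonomial_eq_monomial]
  exact isWeightedHomogeneous_monomial _ _ _
    (weight_arcExponent (nestFreeMatchings_subset_perfectMatchings hM) B)

/-! ### §3 Freeing the arcs at a vertex set: a projection -/

/-- A substitution by free inputs (`L₊ = 0` each, e.g. `1` or a variable) costs nothing.
[folklore] -/
theorem complexity_aeval_le_of_free {τ : Type*} [Fintype τ] (g : τ → MvPolynomial τ ℝ≥0)
    (hg : ∀ i, complexity (g i) = 0) (p : MvPolynomial τ ℝ≥0) :
    complexity (aeval g p) ≤ complexity p := by
  refine (complexity_aeval_le _ _).trans ?_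
  simp only [hg, Finset.sum_const_zero, add_zero, le_refl]

/-- A substitution sending every variable of `p` to `1` turns `p` into the constant `Σ coeff`.
[folklore] -/
theorem aeval_eq_C_sum_coeff {τ : Type*} (g : τ → MvPolynomial τ ℝ≥0) {p : MvPolynomial τ ℝ≥0}
    (hp : ∀ d ∈ p.support, ∀ e ∈ d.support, g e = 1) :
    aeval g p = C (∑ d ∈ p.support, coeff d p) := by
  classical
  conv_lhs => rw [p.as_sum]
  rw [map_sum, map_sum]
  refine Finset.sum_congr rfl fun d hd => ?_
  rw [aeval_monomial, ← C_eq_algebraMap]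
  suffices h : (d.prod fun v k => g v ^ k) = 1 by rw [h, mul_one]
  refine Finset.prod_eq_one fun v hv => ?_
  show g v ^ (d v) = 1
  rw [hp d hd v hv, one_pow]

/-- Over `ℝ≥0`, multiplying by a nonzero constant does not change the support. [folklore] -/
theorem support_mul_C_of_ne_zero {τ : Type*} (p : MvPolynomial τ ℝ≥0) {η : ℝ≥0} (hη : η ≠ 0) :
    (p * C η).support = p.support := by
  ext d
  rw [mem_support_iff, mem_support_iff, mul_comm, coeff_C_mul]
  exact (mul_ne_zero_iff.trans (and_iff_right hη))

/-! ### §4 The stub -/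

/-- **S1 — a cofactor of degree `δ` buys at most `2δ` freed vertices** (registered stub
`stub_cofactorBuysVertices` of line `freed_vertices`, signature verbatim): for every nonzero
`h ∈ ℝ≥0[x_(i,j)]` there are a vertex set `R ⊆ [2n]`, `|R| ≤ 2·deg h`, and a polynomial `q` with the
support of `NN_n^R := NN_n[x_e := 1 for every arc e touching R]` and `L₊(q) ≤ L₊(NN_n · h)`; namely
`q := (NN_n · top_w h)[R-arcs := 1]` for the vertex potential `w = vertexWeight (2·deg h + 1)`.
[folklore] -/
theorem stub_cofactorBuysVertices :
    ∀ (n : ℕ) (h : MvPolynomial (Fin (2 * n) × Fin (2 * n)) ℝ≥0), h ≠ 0 →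
      ∃ R : Finset (Fin (2 * n)), R.card ≤ 2 * h.totalDegree ∧
        ∃ q : MvPolynomial (Fin (2 * n) × Fin (2 * n)) ℝ≥0,
          q.support = (MvPolynomial.aeval (fun e : Fin (2 * n) × Fin (2 * n) =>
              if e.1 ∈ R ∨ e.2 ∈ R then (1 : MvPolynomial (Fin (2 * n) × Fin (2 * n)) ℝ≥0)
              else MvPolynomial.X e) (nestFreeMatchingPoly n ℝ≥0)).support ∧
          complexity q ≤ complexity (nestFreeMatchingPoly n ℝ≥0 * h) := by
  intro n h hh
  obtain ⟨R, hRcard, hR⟩ := exists_vertices_topComponent hh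
  set W := vertexWeight (m := 2 * n) (2 * h.totalDegree + 1) with hW
  set hs := topComponent W h with hhs
  have hne : hs ≠ 0 := topComponent_ne_zero _ hh
  have hη : (∑ d ∈ hs.support, coeff d hs) ≠ 0 := sum_coeff_ne_zero hne
  refine ⟨R, hRcard, MvPolynomial.aeval (fun e : Fin (2 * n) × Fin (2 * n) =>
      if e.1 ∈ R ∨ e.2 ∈ R then (1 : MvPolynomial (Fin (2 * n) × Fin (2 * n)) ℝ≥0)
      else MvPolynomial.X e) (nestFreeMatchingPoly n ℝ≥0 * hs), ?_, ?_⟩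
  · -- support: the cofactor's top component becomes a nonzero constant
    have hφ : MvPolynomial.aeval (fun e : Fin (2 * n) × Fin (2 * n) =>
        if e.1 ∈ R ∨ e.2 ∈ R then (1 : MvPolynomial (Fin (2 * n) × Fin (2 * n)) ℝ≥0)
        else MvPolynomial.X e) hs = C (∑ d ∈ hs.support, coeff d hs) :=
      aeval_eq_C_sum_coeff _ fun d hd e he => if_pos (Or.inl (hR d hd e he).1)
    rw [map_mul, hφ, support_mul_C_of_ne_zero _ hη]
  · -- complexity: projection, then initial forms are free and `NN_n` is `W`-homogeneous
    have hfree : ∀ e : Fin (2 * n) × Fin (2 * n), complexity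
        (if e.1 ∈ R ∨ e.2 ∈ R then (1 : MvPolynomial (Fin (2 * n) × Fin (2 * n)) ℝ≥0)
          else MvPolynomial.X e) = 0 := by
      intro e
      by_cases he : e.1 ∈ R ∨ e.2 ∈ R
      · rw [if_pos he, ← C_1]; exact complexity_C_holds _
      · rw [if_neg he]; exact complexity_X_holds _
    calc complexity (MvPolynomial.aeval (fun e : Fin (2 * n) × Fin (2 * n) =>
            if e.1 ∈ R ∨ e.2 ∈ R then (1 : MvPolynomial (Fin (2 * n) × Fin (2 * n)) ℝ≥0)
            else MvPolynomial.X e) (nestFreeMatchingPoly n ℝ≥0 * hs))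
        ≤ complexity (nestFreeMatchingPoly n ℝ≥0 * hs) := complexity_aeval_le_of_free _ hfree _
      _ ≤ complexity (nestFreeMatchingPoly n ℝ≥0 * h) := by
          have := complexity_topComponent_le W (nestFreeMatchingPoly n ℝ≥0 * h)
          rwa [topComponent_mul, topComponent_eq_self_of_isWeightedHomogeneous W
            (isWeightedHomogeneous_nestFreeMatchingPoly n _)] at this

end Summit.ValiantsHypothesis.ValiantsHypothesis.Theorems.FifoMatching.NNLowDegreeCofactorHard

end
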